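import Literature.Analysis.FluidPDE.GKPRigidityBackwardUniqueness
import Literature.Analysis.FluidPDE.PineauVicolCylinderRegularity
import Literature.Analysis.FluidPDE.CurlFreeLiouville
import Literature.Analysis.FluidPDE.ClassicalSolutionGlue
import Literature.Analysis.FluidPDE.SelfSimilar
import HarnessLib

/-!
# No weak healing of a Type-I singularity — crux stmt-NavierStokesRegularity-1404
  (`QuantisedSymmetry.PolyhedralDssProfileExists`), line polyhedral_cell, stub stub_noWeakHealing (N19)

Registered stub `stub_noWeakHealing` (`--supports stmt-NavierStokesRegularity-1404`). Let `(V, p)` be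
a classical solution of Navier–Stokes (`ν = 1`, zero force) on the open past `(-∞, 0)` with the
Type-I space–time bound `HasTypeIDecay C₀ V`, `‖V(t,x)‖ ≤ C₀ / (‖x‖ + √(-t))`. If the slices tend
to zero weakly as `t ↑ 0` — `∫ ⟪V(t,x), φ(x)⟫ dx → 0` for every smooth compactly supported `φ` —
then `V ≡ 0` on the past ("a Type-I singularity cannot heal").

Proof sketch.
* Far field (`noWeakHealing_farField`): by Pineau–Vicol's Lemma 7.1 in physical variables
  (`PineauVicol2026.exists_forall_iteratedFDeriv_le_of_typeI n C₀`),
  `‖Dⁿₓ V(t)(x)‖ ≤ Kₙ · max(‖x‖, √(-t))^{-(n+1)} ≤ Kₙ` on `{‖x‖ ≥ 1}`, so the derivatives of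
  order `≤ 3` are bounded by `K = K₀ + K₁ + K₂ + K₃` outside the closed unit ball, at all `t < 0`.
* Vorticity (`noWeakHealing_curl`): fix `t < 0` and put `T = 1 - t > 1`. The translate
  `u(s) = V(s - T)` is classical on `(0, T)` (`IsClassicalNSSolutionOn.comp_add_right`, `.mono`),
  obeys the far-field bounds on `(1/2, T) × {‖x‖ > 1}`, and its slices tend to zero weakly as
  `s ↑ T` (compose with the translation `s ↦ s - T`, `𝓝[<] T → 𝓝[<] 0`). The tree theorem
  `IsClassicalNSSolutionOn.curl_eq_zero_of_farField_of_tendsto` (ESS backward uniqueness in the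
  far field and unique continuation of the vorticity; GKP 2016 §2.5 Step D) gives
  `curl u(s) ≡ 0` for `s ∈ (1/2, T)`, in particular at `s = 1`, i.e. `curl V(t) ≡ 0`.
* Liouville: the slice `V(t)` is smooth, curl free, divergence free and bounded by `C₀/√(-t)`,
  hence constant (`eq_of_curl_eq_zero_of_isDivFree_of_bounded`, KNSS 2009 Lemma 3.1), and the
  constant is zero because `‖V(t,x)‖ ≤ C₀/(‖x‖ + √(-t)) → 0` as `‖x‖ → ∞`.
-/

noncomputable section

-- the summit namespace `…NavierStokesRegularity.NavierStokesRegularity…` is the tree convention (D-0017)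
set_option linter.dupNamespace false

namespace Summit.NavierStokesRegularity.NavierStokesRegularity.Theorems.PolyhedralDssProfileExists.PolyhedralCell

open MeasureTheory Set Function Filter Topology Metric
open Literature.Analysis Literature.Analysis.FluidPDE
open scoped InnerProductSpace RealInnerProductSpace

/-! ### Far-field derivative bounds for Type-I classical solutions -/

/-- **Uniform far-field bounds.** For every `C₀` there is `K` such that every classical solution
`(V, p)` of Navier–Stokes (`ν = 1`, `f = 0`) on `(-∞, 0)` with `‖V(t,x)‖ ≤ C₀/(‖x‖ + √(-t))` has
`‖Dⁿₓ V(t)(x)‖ ≤ K` for all `n ≤ 3`, `t < 0`, `‖x‖ ≥ 1`: Pineau–Vicol's Lemma 7.1 in physical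
variables gives `‖Dⁿₓ V(t)(x)‖ ≤ Kₙ · max(‖x‖, √(-t))^{-(n+1)}` and `max(‖x‖, √(-t)) ≥ 1` there.
[cite: PineauVicol2026, Lemma 7.1] -/
theorem noWeakHealing_farField (C₀ : ℝ) :
    ∃ K : ℝ, ∀ (V : ℝ → EuclideanSpace ℝ (Fin 3) → EuclideanSpace ℝ (Fin 3))
      (p : ℝ → EuclideanSpace ℝ (Fin 3) → ℝ),
      IsClassicalNSSolutionOn (Iio 0) 1 0 V p → HasTypeIDecay C₀ V →
      ∀ n ≤ 3, ∀ t < 0, ∀ x : EuclideanSpace ℝ (Fin 3), 1 ≤ ‖x‖ →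
        ‖iteratedFDeriv ℝ n (V t) x‖ ≤ K := by
  choose K hK0 hK using fun n => PineauVicol2026.exists_forall_iteratedFDeriv_le_of_typeI n C₀
  refine ⟨K 0 + K 1 + K 2 + K 3, fun V p hcl hI n hn t ht x hx => ?_⟩
  have hI' : ∀ s ∈ Iio (0 : ℝ), ∀ y : EuclideanSpace ℝ (Fin 3),
      ‖V s y‖ ≤ C₀ / (‖y‖ + Real.sqrt (-s)) := fun s hs y => hI s hs y
  have hm : 1 ≤ max ‖x‖ (Real.sqrt (-t)) := le_max_of_le_left hx
  have hfac : ((max ‖x‖ (Real.sqrt (-t)))⁻¹) ^ (n + 1) ≤ 1 :=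
    pow_le_one₀ (inv_nonneg.2 (zero_le_one.trans hm)) (inv_le_one_of_one_le₀ hm)
  have h1 : ‖iteratedFDeriv ℝ n (V t) x‖ ≤ K n :=
    (hK n V p hcl hI' t ht x).trans
      ((mul_le_mul_of_nonneg_left hfac (hK0 n)).trans_eq (mul_one _))
  have h2 : K n ≤ K 0 + K 1 + K 2 + K 3 := by
    have h0 := hK0 0; have h1 := hK0 1; have h2 := hK0 2; have h3 := hK0 3
    interval_cases n <;> linarith
  exact h1.trans h2

/-! ### The vorticity of every negative slice vanishes -/

/-- **Step D at every negative time.** For a Type-I classical solution `(V, p)` on `(-∞, 0)`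
whose slices tend to zero weakly as `t ↑ 0`, `curl V(t) ≡ 0` for every `t < 0`: translate time
by `T = 1 - t`, so that `u(s) = V(s - T)` is classical on `(0, T)` with far-field bounds on
`(1/2, T) × {‖x‖ > 1}` (`noWeakHealing_farField`) and weakly vanishing slices as `s ↑ T`, and
apply `IsClassicalNSSolutionOn.curl_eq_zero_of_farField_of_tendsto` at `s = 1 ∈ (1/2, T)`.
[cite: GKP2016, §2.5 (proof of Prop. 2.3, Step D)] -/
theorem noWeakHealing_curl {V : ℝ → EuclideanSpace ℝ (Fin 3) → EuclideanSpace ℝ (Fin 3)}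
    {p : ℝ → EuclideanSpace ℝ (Fin 3) → ℝ} {C₀ : ℝ}
    (hcl : IsClassicalNSSolutionOn (Iio 0) 1 0 V p) (hI : HasTypeIDecay C₀ V)
    (hweak : ∀ φ : EuclideanSpace ℝ (Fin 3) → EuclideanSpace ℝ (Fin 3),
      FunctionSpaces.IsTestFunctionOn (⊤ : TopologicalSpace.Opens (EuclideanSpace ℝ (Fin 3))) φ →
        Tendsto (fun t => ∫ x, ⟪V t x, φ x⟫_ℝ) (𝓝[<] 0) (𝓝 0)) :
    ∀ t < 0, ∀ x, curl (V t) x = 0 := by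
  obtain ⟨K, hK⟩ := noWeakHealing_farField C₀
  intro t ht
  -- the time translation
  set T : ℝ := 1 - t with hT
  have hT1 : 1 < T := by rw [hT]; linarith
  set u : ℝ → EuclideanSpace ℝ (Fin 3) → EuclideanSpace ℝ (Fin 3) := fun s => V (s + -T) with hu
  set π : ℝ → EuclideanSpace ℝ (Fin 3) → ℝ := fun s => p (s + -T) with hπ
  have hclu' : IsClassicalNSSolutionOn ((· + -T) ⁻¹' Iio 0) 1 0 u π := hcl.comp_add_right (-T)
  have hsub : Ioo 0 T ⊆ (· + -T) ⁻¹' Iio (0 : ℝ) := fun s hs => by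
    simp only [mem_preimage, mem_Iio]
    linarith [hs.2]
  have hclu : IsClassicalNSSolutionOn (Ioo 0 T) 1 0 u π := hclu'.mono hsub (uniqueDiffOn_Ioo 0 T)
  -- far-field bounds on `(1/2, T) × {‖x‖ > 1}`
  have hbd : ∀ n ≤ 3, ∀ w ∈ Ioo (1 / 2 : ℝ) T ×ˢ (closedBall (0 : EuclideanSpace ℝ (Fin 3)) 1)ᶜ,
      ‖iteratedFDeriv ℝ n (u w.1) w.2‖ ≤ K := by
    rintro n hn ⟨s, x⟩ ⟨hs, hx⟩
    have hx' : 1 ≤ ‖x‖ := by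
      simp only [mem_compl_iff, mem_closedBall, dist_zero_right, not_le] at hx
      exact hx.le
    have hsT : s + -T < 0 := by simp only [mem_Ioo] at hs; linarith [hs.2]
    exact hK V p hcl hI n hn (s + -T) hsT x hx'
  -- weak vanishing of the slices as `s ↑ T`
  have hshift : Tendsto (fun s : ℝ => s + -T) (𝓝[<] T) (𝓝[<] 0) := by
    refine tendsto_nhdsWithin_of_tendsto_nhds_of_eventually_within _ ?_ ?_
    · have h := ((continuous_add_const (-T)).tendsto T).mono_left
        (nhdsWithin_le_nhds (s := Iio T))
      rwa [add_neg_cancel] at h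
    · filter_upwards [self_mem_nhdsWithin] with s hs
      simp only [mem_Iio] at hs ⊢
      linarith
  have hfinal : ∀ φ : EuclideanSpace ℝ (Fin 3) → EuclideanSpace ℝ (Fin 3),
      FunctionSpaces.IsTestFunctionOn (⊤ : TopologicalSpace.Opens (EuclideanSpace ℝ (Fin 3))) φ →
        Tendsto (fun s => ∫ x, ⟪u s x, φ x⟫_ℝ) (𝓝[<] T) (𝓝 0) := fun φ hφ =>
    (hweak φ hφ).comp hshift
  have hcurl := hclu.curl_eq_zero_of_farField_of_tendsto one_pos (by norm_num : (0 : ℝ) < 1 / 2)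
    (by linarith) zero_le_one hbd hfinal
  -- read off at `s = 1`, `u 1 = V t`
  have h1 : (1 : ℝ) ∈ Ioo (1 / 2 : ℝ) T := ⟨by norm_num, hT1⟩
  have e : (1 : ℝ) + -T = t := by rw [hT]; ring
  intro x
  have h := hcurl 1 h1 x
  simp only [hu] at h
  rwa [e] at h

/-! ### The registered stub -/

/-- **Stub N19: no weak healing at the blow-up time.** Let `(V, p)` be a classical solution of
Navier–Stokes (`ν = 1`, zero force) on the open past with the Type-I bound `HasTypeIDecay C₀ V`.
If the slices tend to zero weakly as `t ↑ 0` — `∫ ⟪V(t,x), φ(x)⟫ dx → 0` for every smooth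
compactly supported `φ` — then `V ≡ 0` on the past: every slice is smooth, curl free
(`noWeakHealing_curl`: ESS backward uniqueness + unique continuation, GKP 2016 §2.5 Step D),
divergence free and bounded by `C₀/√(-t)`, hence constant by Liouville's theorem for
`curl = 0, div = 0` (`eq_of_curl_eq_zero_of_isDivFree_of_bounded`, KNSS 2009 Lemma 3.1), and the
constant vanishes since `‖V(t,x)‖ ≤ C₀/(‖x‖ + √(-t)) → 0` as `‖x‖ → ∞`.
[cite: GKP2016, §2.5 (proof of Prop. 2.3, Step D)]
[cite: KochNadirashviliSereginSverak2009, Lemma 3.1] -/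
theorem stub_noWeakHealing :
    ∀ (V : ℝ → EuclideanSpace ℝ (Fin 3) → EuclideanSpace ℝ (Fin 3))
      (p : ℝ → EuclideanSpace ℝ (Fin 3) → ℝ) (C₀ : ℝ),
      IsClassicalNSSolutionOn (Set.Iio 0) 1 0 V p → HasTypeIDecay C₀ V →
      (∀ φ : EuclideanSpace ℝ (Fin 3) → EuclideanSpace ℝ (Fin 3),
        Literature.Analysis.FunctionSpaces.IsTestFunctionOn
          (⊤ : TopologicalSpace.Opens (EuclideanSpace ℝ (Fin 3))) φ →
        Tendsto (fun t => ∫ x, ⟪V t x, φ x⟫_ℝ) (𝓝[<] 0) (𝓝 0)) →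
      ∀ t < 0, ∀ x, V t x = 0 := by
  intro V p C₀ hcl hI hweak t ht x
  have hcurl := noWeakHealing_curl hcl hI hweak t ht
  -- `0 ≤ C₀` from the bound at one point
  have hs : 0 < Real.sqrt (-t) := Real.sqrt_pos.2 (by linarith)
  have hC₀ : 0 ≤ C₀ := by
    have h0 := (norm_nonneg _).trans (hI t ht 0)
    rw [norm_zero, zero_add, le_div_iff₀ hs, zero_mul] at h0
    exact h0
  -- the slice is bounded, hence constant
  have hbound : ∀ y, ‖V t y‖ ≤ C₀ / Real.sqrt (-t) := fun y =>
    (hI t ht y).trans (div_le_div_of_nonneg_left hC₀ hs (le_add_of_nonneg_left (norm_nonneg _)))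
  have hconst : ∀ y z, V t y = V t z := fun y z =>
    eq_of_curl_eq_zero_of_isDivFree_of_bounded ((hcl.contDiff_velocity ht).of_le (by norm_cast))
      hcurl (hcl.divFree t ht) hbound y z
  -- and the constant is zero: test the Type-I bound far out on the first axis
  by_contra hne
  have hpos : 0 < ‖V t x‖ := norm_pos_iff.2 hne
  set r : ℝ := C₀ / ‖V t x‖ + 1 with hr
  have hr0 : 0 < r := by rw [hr]; positivity
  set y : EuclideanSpace ℝ (Fin 3) := r • EuclideanSpace.basisFun (Fin 3) ℝ 0 with hy
  have hny : ‖y‖ = r := by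
    rw [hy, norm_smul, Real.norm_eq_abs, (EuclideanSpace.basisFun (Fin 3) ℝ).orthonormal.1 0,
      mul_one, abs_of_pos hr0]
  have key := hI t ht y
  rw [← hconst x y, hny, le_div_iff₀ (by positivity : (0 : ℝ) < r + Real.sqrt (-t))] at key
  have e : ‖V t x‖ * r = C₀ + ‖V t x‖ := by
    rw [hr, mul_add, mul_one, mul_div_cancel₀ _ hpos.ne']
  nlinarith [mul_pos hpos hs]

end Summit.NavierStokesRegularity.NavierStokesRegularity.Theorems.PolyhedralDssProfileExists.PolyhedralCell

end
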